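import Literature.NumberTheory.EllipticCurves.BSDSha
import Literature.NumberTheory.EllipticCurves.ShaTorsion
import Literature.NumberTheory.EllipticCurves.ShaFiniteProofs
import Literature.GroupTheory.FiniteAbelian.LevelwisePairingAssembly
import HarnessLib

/-!
# The Cassels–Tate fact from the fixed-level theorem: `exists_casselsTate_pairing` reduced to single prime-power levels

Topic `NumberTheory/EllipticCurves`; namespace `WeierstrassCurve`. Theorems only: **no named fact is
introduced** (D-0026).

The named fact `WeierstrassCurve.exists_casselsTate_pairing` (Silverman, *AEC*, Thm. X.4.14: an
alternating bi-additive pairing on `Ш(E/K)` whose kernel is exactly the divisible elements) is here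
REDUCED to Milne's fixed-level theorem (*ADT* I §6: Prop. 6.9 constructs the alternating pairing on
`Ш[m]`; Lemma 6.17 with the final diagram of the proof of Thm. 6.13(a) gives
"`⟨a, Ш[m]⟩ = 0 ⇒ a ∈ mШ`"; the first case of the definition gives "`a ∈ mШ ⇒ ⟨a, ·⟩ = 0`"), ONE
prime-power level at a time and with no compatibility between the levels — by the pure-algebra
assembly `Literature.GroupTheory.FiniteAbelian.exists_pairing_forall_eq_zero_iff_mem_divHull`
(`LevelwisePairingAssembly.lean`), whose hypotheses "`Ш` torsion" and "`Ш[n]` finite" are the tree's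
theorems `WeierstrassCurve.isTorsion_sha` (`ShaTorsion.lean`) and
`WeierstrassCurve.finite_sha_torsionBy_holds` (`ShaFiniteProofs.lean`, from the finiteness of the
Selmer groups, *AEC* X.4.2(b)).

* `exists_casselsTate_pairing_of_levelwise`: if for every elliptic `W` over `K` and every prime power
  `q = p^k` (`k > 0`) there is an alternating `B_q : Ш[q] × Ш[q] → ℚ/ℤ` with
  `(∀ a' ∈ Ш[q], B_q(a, a') = 0) ↔ a ∈ qШ` (`IsLevelPairing`), then `exists_casselsTate_pairing`
  holds over `K`.

This replaces, for the purposes of the provefact unit, the compatible-family route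
`exists_casselsTate_pairing_iff_family` (`BSDShaCasselsTateKernelProofs.lean`): the Poitou–Tate input
of the tree (`poitouTate_sum_localTatePairing_eq_zero`) provides the local invariant maps one level at
a time, without compatibility between levels, which is exactly what the level-wise form consumes.

## References

* [SilvermanAEC2009] J. H. Silverman, *The Arithmetic of Elliptic Curves*, 2nd ed., Thm. X.4.14,
  Thm. X.4.2(b).
* [MilneADT2006] J. S. Milne, *Arithmetic Duality Theorems*, 2nd ed. (2006), I §6, Prop. 6.9,
  Lemma 6.17, Thm. 6.13(a).
-/

open scoped AddSubgroup

universe u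

namespace WeierstrassCurve

open Literature.GroupTheory.FiniteAbelian

variable {K : Type u} [Field K] [NumberField K]

/-- Membership in the tree's `AddSubgroup.divisibleElements` is membership in the algebra file's
`divHull` (both: divisible by every positive integer). [folklore] -/
theorem mem_divisibleElements_iff_mem_divHull {A : Type*} [AddCommGroup A] (x : A) :
    x ∈ AddSubgroup.divisibleElements A ↔ x ∈ divHull A :=
  Iff.rfl

/-- **The Cassels–Tate fact from the fixed-level theorem.** Suppose that for every elliptic curve
`E = W` over the number field `K` and every prime power `q = p^k`, `k > 0`, there is an alternating
bi-additive pairing `B_q` on `Ш(E/K)[q]` with values in `ℚ/ℤ` whose kernel is `Ш[q] ∩ qШ`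
(`IsLevelPairing`: Milne's fixed-level Cassels–Tate theorem). Then
`WeierstrassCurve.exists_casselsTate_pairing` holds over `K` (Silverman, *AEC*, Thm. X.4.14): `Ш` is
torsion (`isTorsion_sha`) with finite `Ш[n]` (`finite_sha_torsionBy_holds`), so the level pairings
assemble (`exists_pairing_forall_eq_zero_iff_mem_divHull`). [cite: SilvermanAEC2009, Thm. X.4.14]
[cite: MilneADT2006, Ch. I §6, Thm. 6.13(a)] -/
theorem exists_casselsTate_pairing_of_levelwise
    (h : ∀ (W : WeierstrassCurve K) [W.IsElliptic] (p k : ℕ), p.Prime → 0 < k →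
      ∃ B : (W.sha)[p ^ k] →+ (W.sha)[p ^ k] →+ AddCircle (1 : ℚ), IsLevelPairing (p ^ k) B) :
    exists_casselsTate_pairing (K := K) := by
  intro W _
  have hfin : ∀ n : ℕ, 0 < n → ((W.sha)[n] : Set W.sha).Finite := fun n hn =>
    @Set.toFinite _ _ (W.finite_sha_torsionBy_holds (n : ℤ) (Int.natCast_ne_zero.mpr hn.ne'))
  obtain ⟨B, halt, hker⟩ :=
    exists_pairing_forall_eq_zero_iff_mem_divHull W.isTorsion_sha hfin fun p k hp hk => h W p k hp hk
  exact ⟨B, halt, fun x => (hker x).trans (mem_divisibleElements_iff_mem_divHull x).symm⟩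

end WeierstrassCurve
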